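import Mathlib
import Literature.NumberTheory.EllipticCurves.ThreeIsogeny
import Literature.NumberTheory.EllipticCurves.MordellCurvePhiDescentHom

/-!
# Rank-2 observatory, KERNEL-3ISO (A3): the `3`-descent map `(x, y) ↦ y - (mx + s)` is a homomorphism

HONEST FRAMING: per-curve certified theorems and census instruments; no claim on BSD in rank ≥ 2.

Cell `bsd-rank2-observatory`, cert-1 leg KERNEL-3ISO, step A3 (see the cell's `KERNEL-3ISO.md`). For the
general curve with a rational `3`-torsion point `E_{m,s} : y² = x³ + (mx + s)²` (the tree's
`threeTorsionModel m s`, predicate `IsVeluThreePair m s W W'`) over a field `F` with `2 ≠ 0`, the map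
`α : E(F) → F*/F*³`, `O ↦ 1`, `(x, y) ↦ y - (mx + s)` for `(x, y) ≠ T = (0, s)`, `T ↦ (2s)²`
(Cohen GTM 239, Def. 8.4.7 / Prop. 8.4.8; for `m = 0` this is the tree's `MordellDescent.cubicDescent`
with `B = -s`, Cassels 1964), is a group homomorphism. Everything here is proved, characteristic-free
except `2 ≠ 0` (which `IsVeluThreePair` forces).

* `prod_sub_line_eq_cube` — the chord identity: for `P₁, P₂ ∈ E(F)` affine, not opposite, with chord
  (tangent) `y = ℓx + μ` and third intersection `(x₃, Y_R)`,
  `∏ᵢ (yᵢ - (m xᵢ + s)) = (μ - s)³`, by Vieta for Mathlib's `addPolynomial_slope`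
  (`e₁ = ℓ² - m²`, `e₂ = 2ms - 2ℓμ`, `e₃ = μ² - s²`, and `∏ ((ℓ - m)xᵢ + (μ - s)) = (μ - s)³`).
* **`cubeClass_descent_add`**: for any function `δ` on `E(F)` with `δ(O) = 1`, `δ(x, y) = y - (mx + s)` off `T`
  and `δ(T) = (2s)²`: `[δ(P + Q)] = [δ(P)][δ(Q)]` in `F*/F*³` (case analysis over the chord–tangent law exactly
  as in the tree's `MordellDescent.cubicDescentClass_add`, using the chord identity for `(m, s)` and for `(-m, -s)`
  and `(y - (mx + s))(y + (mx + s)) = x³`).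
* `exists_threeDescentHom` — the map bundled: there is `κ : E(F) →+ Additive (F*/F*³)` with these values (the `κ`
  of the index bound `ThreeIso.three_pow_mordellWeilRank_succ_le_of_zsmul`); `descent_eq_zero_iff` — its kernel at
  an affine point: `y - (mx + s)` a non-zero cube off `T`, and at `T` iff `(2s)²` (equivalently `2s`) is a cube.
  The file adds NO definitions (the descent map is specified by its values), so that per-row certificate files can
  instantiate it by `obtain`.

References: [Cohen2007NumberTheoryI] H. Cohen, GTM 239, §8.4.3 (Def. 8.4.7, Prop. 8.4.8, Thm. 8.1.7 pattern);
[CohenPazuki2009] §2; [Cassels1964ArithmeticVI] p. 65; tree template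
`Literature.NumberTheory.EllipticCurves.MordellCurvePhiDescentHom`.
-/

noncomputable section

set_option linter.dupNamespace false

open scoped Classical

open WeierstrassCurve Polynomial

namespace Summit.BirchSwinnertonDyer.BirchSwinnertonDyer.Rank2Observatory.ThreeIsoDescent

open Literature.NumberTheory.EllipticCurves Literature.NumberTheory.EllipticCurves.MordellDescent

variable {F : Type*} [Field F] {m s : F} {W W' : WeierstrassCurve F}

/-! ## Curve identities on `y² = x³ + (mx + s)²` -/

/-- On `E_{m,s}`: `(y - (mx + s))(y + (mx + s)) = x³`. [folklore] -/
theorem mul_conj_eq_cube (h : IsVeluThreePair m s W W') {x y : F} (hP : W.toAffine.Equation x y) :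
    (y - (m * x + s)) * (y + (m * x + s)) = x ^ 3 := by
  rw [h.equation_iff] at hP; linear_combination hP

/-- On `E_{m,s}`: `y = mx + s` forces `(x, y) = (0, s) = T`. [folklore] -/
theorem eq_T_of_eq (h : IsVeluThreePair m s W W') {x y : F} (hP : W.toAffine.Equation x y)
    (hy : y = m * x + s) : x = 0 ∧ y = s := by
  have h3 : x ^ 3 = 0 := by rw [← mul_conj_eq_cube h hP, hy]; ring
  have hx : x = 0 := pow_eq_zero_iff three_ne_zero |>.mp h3
  exact ⟨hx, by rw [hy, hx]; ring⟩

/-- On `E_{m,s}`: `y = -(mx + s)` forces `(x, y) = (0, -s) = -T`. [folklore] -/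
theorem eq_negT_of_eq (h : IsVeluThreePair m s W W') {x y : F} (hP : W.toAffine.Equation x y)
    (hy : y + (m * x + s) = 0) : x = 0 ∧ y = -s := by
  have h3 : x ^ 3 = 0 := by rw [← mul_conj_eq_cube h hP, hy]; ring
  have hx : x = 0 := pow_eq_zero_iff three_ne_zero |>.mp h3
  exact ⟨hx, by rw [hx] at hy; linear_combination hy⟩

/-- The predicate is invariant under `(m, s) ↦ (-m, -s)` (the curves only see `m²`, `ms`, `s²`, `m³s`).
[folklore] -/
theorem isVeluThreePair_neg (h : IsVeluThreePair m s W W') : IsVeluThreePair (-m) (-s) W W' where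
  a₁_eq := h.a₁_eq
  a₂_eq := by rw [h.a₂_eq]; ring
  a₃_eq := h.a₃_eq
  a₄_eq := by rw [h.a₄_eq]; ring
  a₆_eq := by rw [h.a₆_eq]; ring
  a₁'_eq := h.a₁'_eq
  a₂'_eq := by rw [h.a₂'_eq]; ring
  a₃'_eq := h.a₃'_eq
  a₄'_eq := by rw [h.a₄'_eq]; ring
  a₆'_eq := by rw [h.a₆'_eq]; ring
  Δ_ne := h.Δ_ne

/-- **The chord identity** on `E_{m,s}`: for affine `P₁ = (x₁, y₁)`, `P₂ = (x₂, y₂)`, not opposite,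
`ℓ` the slope of the chord (tangent) and `(x₃, Y_R)`, `Y_R = ℓ(x₃ - x₁) + y₁` (Mathlib's `negAddY`),
the third intersection: `(y₁ - (mx₁ + s))(y₂ - (mx₂ + s))(Y_R - (mx₃ + s)) = (y₁ - ℓx₁ - s)³`.
Vieta for `addPolynomial_slope`. [folklore] -/
theorem prod_sub_line_eq_cube (h : IsVeluThreePair m s W W') {x₁ x₂ y₁ y₂ : F}
    (h₁ : W.toAffine.Equation x₁ y₁) (h₂ : W.toAffine.Equation x₂ y₂)
    (hxy : ¬(x₁ = x₂ ∧ y₁ = W.toAffine.negY x₂ y₂)) :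
    (y₁ - (m * x₁ + s)) * (y₂ - (m * x₂ + s)) *
        (W.toAffine.negAddY x₁ x₂ y₁ (W.toAffine.slope x₁ x₂ y₁ y₂) -
          (m * W.toAffine.addX x₁ x₂ (W.toAffine.slope x₁ x₂ y₁ y₂) + s)) =
      (y₁ - W.toAffine.slope x₁ x₂ y₁ y₂ * x₁ - s) ^ 3 := by
  have hpoly := Affine.addPolynomial_slope h₁ h₂ hxy
  rw [Affine.addPolynomial_eq, Cubic.prod_X_sub_C_eq, neg_inj, Cubic.toPoly_injective] at hpoly
  simp only [h.a₁_eq, h.a₂_eq, h.a₃_eq, h.a₄_eq, h.a₆_eq, Cubic.mk.injEq] at hpoly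
  obtain ⟨-, he₁, he₂, he₃⟩ := hpoly
  set ℓ := W.toAffine.slope x₁ x₂ y₁ y₂ with hℓ
  set x₃ := W.toAffine.addX x₁ x₂ ℓ with hx₃
  have hy₂ : y₂ = ℓ * (x₂ - x₁) + y₁ := y₂_eq_line h₁ h₂ hxy
  have hnY : W.toAffine.negAddY x₁ x₂ y₁ ℓ = ℓ * (x₃ - x₁) + y₁ := rfl
  rw [hnY, hy₂]
  linear_combination ((ℓ - m) * (y₁ - ℓ * x₁ - s) ^ 2) * he₁ +
    (-((ℓ - m) ^ 2 * (y₁ - ℓ * x₁ - s))) * he₂ + (ℓ - m) ^ 3 * he₃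

/-! ## The descent map -/

/-- A descent value function never vanishes (`2s ≠ 0`). [folklore] -/
theorem descent_ne_zero (h2s : (2 : F) * s ≠ 0) (δ : W.toAffine.Point → F) (hδ0 : δ 0 = 1)
    (hδ : ∀ x y (hP : W.toAffine.Nonsingular x y),
      δ (.some x y hP) = if y = m * x + s then (2 * s) ^ 2 else y - (m * x + s))
    (P : W.toAffine.Point) : δ P ≠ 0 := by
  rcases P with _ | ⟨x, y, hP⟩
  · rw [← Affine.Point.zero_def, hδ0]; exact one_ne_zero
  · rw [hδ]
    split_ifs with hy
    · exact pow_ne_zero 2 h2s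
    · exact sub_ne_zero.mpr hy

/-- **`α` is a homomorphism `E_{m,s}(F) → F*/F*³`**: `[α(P + Q)] = [α(P)][α(Q)]`. Case analysis over
the chord–tangent law; in each case an explicit `w` with `α(P) α(Q) = α(P + Q) w³` comes from the chord
identities for `(m, s)` and `(-m, -s)` and from `(y - (mx + s))(y + (mx + s)) = x³` at `P`, `Q` and the
third point of the chord. [cite: Cohen2007NumberTheoryI, Prop. 8.4.8 (and the proof pattern of Thm. 8.2.4)] -/
theorem cubeClass_descent_add (h : IsVeluThreePair m s W W') (δ : W.toAffine.Point → F) (hδ0 : δ 0 = 1)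
    (hδ : ∀ x y (hP : W.toAffine.Nonsingular x y),
      δ (.some x y hP) = if y = m * x + s then (2 * s) ^ 2 else y - (m * x + s))
    (P Q : W.toAffine.Point) : cubeClass (δ (P + Q)) = cubeClass (δ P) * cubeClass (δ Q) := by
  have h2 : (2 : F) ≠ 0 := h.two_ne
  have hs : s ≠ 0 := h.s_ne
  have h2s : (2 : F) * s ≠ 0 := mul_ne_zero h2 hs
  have h2s2 : ((2 : F) * s) ^ 2 ≠ 0 := pow_ne_zero 2 h2s
  have hss : s ≠ -s := fun e => h2s (by linear_combination e)
  have hnegY : ∀ x y : F, W.toAffine.negY x y = -y := h.negY_eq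
  have h' := isVeluThreePair_neg h
  rcases P with _ | ⟨x₁, y₁, h₁⟩
  · rw [← Affine.Point.zero_def, zero_add, hδ0, cubeClass_one, CubeUnits.one_mul]
  rcases Q with _ | ⟨x₂, y₂, h₂⟩
  · rw [← Affine.Point.zero_def, add_zero, hδ0, cubeClass_one, CubeUnits.mul_one]
  have hc₁ := mul_conj_eq_cube h h₁.left
  have hc₂ := mul_conj_eq_cube h h₂.left
  have hsub : ∀ {x y : F}, y ≠ m * x + s → y - (m * x + s) ≠ 0 := fun hy => sub_ne_zero.mpr hy
  by_cases hopp : x₁ = x₂ ∧ y₁ = W.toAffine.negY x₂ y₂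
  · /- `Q = -P`: `P + Q = O` -/
    rw [Affine.Point.add_of_Y_eq hopp.1 hopp.2, hδ0, cubeClass_one]
    obtain ⟨hx, hy⟩ := hopp
    rw [hnegY] at hy
    rw [hδ, hδ]
    by_cases hy₁ : y₁ = m * x₁ + s
    · -- `P = T`, `Q = -T`: `(2s)² · (-2s) = (-2s)³`
      obtain ⟨hx₁, hy₁'⟩ := eq_T_of_eq h h₁.left hy₁
      have hx₂ : x₂ = 0 := hx ▸ hx₁
      have hy₂ : y₂ = -s := by linear_combination hy - hy₁'
      rw [if_pos hy₁, if_neg (by rw [hy₂, hx₂]; intro e; exact hss (by linear_combination -e)), hy₂, hx₂,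
        ← cubeClass_mul h2s2 (by intro e; exact h2s (by linear_combination -e)),
        show (2 * s) ^ 2 * (-s - (m * 0 + s)) = (-(2 * s)) ^ 3 by ring, cubeClass_pow_three]
    by_cases hy₂ : y₂ = m * x₂ + s
    · -- `P = -T`, `Q = T`
      obtain ⟨hx₂, hy₂'⟩ := eq_T_of_eq h h₂.left hy₂
      have hx₁ : x₁ = 0 := hx.trans hx₂
      have hy₁' : y₁ = -s := by linear_combination hy - hy₂'
      rw [if_neg hy₁, if_pos hy₂, hy₁', hx₁, ← cubeClass_mul (by intro e; exact h2s (by linear_combination -e))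
        h2s2, show (-s - (m * 0 + s)) * (2 * s) ^ 2 = (-(2 * s)) ^ 3 by ring, cubeClass_pow_three]
    · -- generic opposite points: `α(P) α(-P) = -(y₁ - (mx₁+s))(y₁ + (mx₁+s)) = (-x₁)³`
      rw [if_neg hy₁, if_neg hy₂, ← cubeClass_mul (hsub hy₁) (hsub hy₂),
        show (y₁ - (m * x₁ + s)) * (y₂ - (m * x₂ + s)) = (-x₁) ^ 3 by
          rw [← hx]; linear_combination (y₁ - (m * x₁ + s)) * hy - hc₁, cubeClass_pow_three]
  · /- the chord (tangent) through `P`, `Q`, and its third point `R = (x₃, Y)` -/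
    have h4 : (4 : F) ≠ 0 := by rw [show (4 : F) = 2 * 2 by norm_num]; exact mul_ne_zero h2 h2
    have hline := y₂_eq_line h₁.left h₂.left hopp
    have hR := Affine.equation_negAdd h₁.left h₂.left hopp
    have Cp := prod_sub_line_eq_cube h h₁.left h₂.left hopp
    have Cm := prod_sub_line_eq_cube h' h₁.left h₂.left hopp
    have hYd : W.toAffine.addY x₁ x₂ y₁ (W.toAffine.slope x₁ x₂ y₁ y₂) =
        -(W.toAffine.negAddY x₁ x₂ y₁ (W.toAffine.slope x₁ x₂ y₁ y₂)) := by
      rw [show W.toAffine.addY x₁ x₂ y₁ (W.toAffine.slope x₁ x₂ y₁ y₂) =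
        W.toAffine.negY (W.toAffine.addX x₁ x₂ (W.toAffine.slope x₁ x₂ y₁ y₂))
          (W.toAffine.negAddY x₁ x₂ y₁ (W.toAffine.slope x₁ x₂ y₁ y₂)) from rfl, hnegY]
    have hYR : W.toAffine.negAddY x₁ x₂ y₁ (W.toAffine.slope x₁ x₂ y₁ y₂) =
        W.toAffine.slope x₁ x₂ y₁ y₂ * (W.toAffine.addX x₁ x₂ (W.toAffine.slope x₁ x₂ y₁ y₂) - x₁) + y₁ :=
      rfl
    have hx₃v := h.addX_eq x₁ x₂ (W.toAffine.slope x₁ x₂ y₁ y₂)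
    rw [Affine.Point.add_some hopp, hδ, hδ, hδ, hYd]
    have hc₃ := mul_conj_eq_cube h hR
    -- name the slope `ℓ`, the third point `(x₃, Y)`
    generalize hℓ : W.toAffine.slope x₁ x₂ y₁ y₂ = ℓ at hline hR Cp Cm hc₃ hYR hx₃v ⊢
    generalize hx₃ : W.toAffine.addX x₁ x₂ ℓ = x₃ at hR hc₃ hYR Cp Cm hx₃v ⊢
    generalize hYdef : W.toAffine.negAddY x₁ x₂ y₁ ℓ = Y at hR Cp Cm hc₃ hYR ⊢
    replace Cm : (y₁ + (m * x₁ + s)) * (y₂ + (m * x₂ + s)) * (Y + (m * x₃ + s)) =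
        (y₁ - ℓ * x₁ + s) ^ 3 := by linear_combination Cm
    by_cases hy₁ : y₁ = m * x₁ + s
    · obtain ⟨hx₁, hy₁'⟩ := eq_T_of_eq h h₁.left hy₁
      by_cases hy₂ : y₂ = m * x₂ + s
      · /- `P = Q = T`: the tangent at `T` has slope `m`, `P + Q = -T = (0, -s)` -/
        obtain ⟨hx₂, hy₂'⟩ := eq_T_of_eq h h₂.left hy₂
        have hℓm : ℓ = m := by
          rw [← hℓ, Affine.slope_of_Y_ne (hx₁.trans hx₂.symm) (fun e => hopp ⟨hx₁.trans hx₂.symm, e⟩),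
            hnegY, h.a₁_eq, h.a₂_eq, h.a₄_eq, hx₁, hy₁',
            div_eq_iff (by intro e; exact h2s (by linear_combination e))]
          ring
        have hx₃0 : x₃ = 0 := by rw [hx₃v, hℓm, hx₁, hx₂]; ring
        have hYv : Y = s := by rw [hYR, hx₃0, hx₁, hy₁']; ring
        rw [if_pos hy₁, if_pos hy₂, if_neg (by rw [hYv, hx₃0]; intro e; exact hss (by linear_combination -e)),
          hYv, hx₃0, ← cubeClass_mul h2s2 h2s2,
          show (2 * s) ^ 2 * (2 * s) ^ 2 = 2 * s * (2 * s) ^ 3 by ring, cubeClass_mul_pow_three h2s h2s,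
          show -s - (m * 0 + s) = -(2 * s) by ring, cubeClass_neg]
      · /- `P = T`, `Q` generic: `(2s)² (y₂ - (mx₂+s)) = -(Y + (mx₃+s)) · (-x₂)³` -/
        have hx₂ : x₂ ≠ 0 := by
          intro hx₂
          rcases h.y_eq_or_of_x_eq_zero (hx₂ ▸ h₂) with e | e
          · exact hy₂ (by rw [e, hx₂]; ring)
          · exact hopp ⟨hx₁.trans hx₂.symm, by rw [hnegY, e, hy₁', neg_neg]⟩
        -- `Cm` at `P = T`: `(2s)(y₂ + (mx₂+s))(Y + (mx₃+s)) = (2s)³`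
        have key0 : (y₂ + (m * x₂ + s)) * (Y + (m * x₃ + s)) = 4 * s ^ 2 := by
          have e : (2 * s) * ((y₂ + (m * x₂ + s)) * (Y + (m * x₃ + s)) - 4 * s ^ 2) = 0 := by
            rw [hy₁', hx₁] at Cm; linear_combination Cm
          exact sub_eq_zero.mp ((mul_eq_zero.mp e).resolve_left h2s)
        have hc₃0 : Y + (m * x₃ + s) ≠ 0 := by
          intro e; rw [e, mul_zero] at key0
          exact hs (pow_eq_zero_iff two_ne_zero |>.mp ((mul_eq_zero.mp key0.symm).resolve_left h4))
        have hYc : ¬(-Y = m * x₃ + s) := fun e => hc₃0 (by linear_combination -e)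
        have key : (2 * s) ^ 2 * (y₂ - (m * x₂ + s)) = -(Y + (m * x₃ + s)) * (-x₂) ^ 3 := by
          rw [neg_pow, show ((-1 : F)) ^ 3 = -1 by norm_num, ← hc₂]
          linear_combination -(y₂ - (m * x₂ + s)) * key0
        rw [if_pos hy₁, if_neg hy₂, if_neg hYc, ← cubeClass_mul h2s2 (hsub hy₂), key,
          show -Y - (m * x₃ + s) = -(Y + (m * x₃ + s)) by ring,
          cubeClass_mul_pow_three (neg_ne_zero.mpr hc₃0) (neg_ne_zero.mpr hx₂)]
    by_cases hy₂ : y₂ = m * x₂ + s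
    · /- `Q = T`, `P` generic: `(y₁ - (mx₁+s)) (2s)² = -(Y + (mx₃+s)) · (-x₁)³` -/
      obtain ⟨hx₂, hy₂'⟩ := eq_T_of_eq h h₂.left hy₂
      have hx₁ : x₁ ≠ 0 := by
        intro hx₁
        rcases h.y_eq_or_of_x_eq_zero (hx₁ ▸ h₁) with e | e
        · exact hy₁ (by rw [e, hx₁]; ring)
        · exact hopp ⟨hx₁.trans hx₂.symm, by rw [hnegY, e, hy₂']⟩
      -- the line through `P` and `T = (0, s)`: `y₁ - ℓ x₁ = s`
      have hμ : y₁ - ℓ * x₁ = s := by rw [hx₂, hy₂'] at hline; linear_combination -hline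
      have key0 : (y₁ + (m * x₁ + s)) * (Y + (m * x₃ + s)) = 4 * s ^ 2 := by
        have e : (2 * s) * ((y₁ + (m * x₁ + s)) * (Y + (m * x₃ + s)) - 4 * s ^ 2) = 0 := by
          have hν : y₁ - ℓ * x₁ + s = 2 * s := by linear_combination hμ
          rw [hy₂', hx₂, hν] at Cm
          linear_combination Cm
        exact sub_eq_zero.mp ((mul_eq_zero.mp e).resolve_left h2s)
      have hc₃0 : Y + (m * x₃ + s) ≠ 0 := by
        intro e; rw [e, mul_zero] at key0
        exact hs (pow_eq_zero_iff two_ne_zero |>.mp ((mul_eq_zero.mp key0.symm).resolve_left h4))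
      have hYc : ¬(-Y = m * x₃ + s) := fun e => hc₃0 (by linear_combination -e)
      have key : (y₁ - (m * x₁ + s)) * (2 * s) ^ 2 = -(Y + (m * x₃ + s)) * (-x₁) ^ 3 := by
        rw [neg_pow, show ((-1 : F)) ^ 3 = -1 by norm_num, ← hc₁]
        linear_combination -(y₁ - (m * x₁ + s)) * key0
      rw [if_neg hy₁, if_pos hy₂, if_neg hYc, ← cubeClass_mul (hsub hy₁) h2s2, key,
        show -Y - (m * x₃ + s) = -(Y + (m * x₃ + s)) by ring,
        cubeClass_mul_pow_three (neg_ne_zero.mpr hc₃0) (neg_ne_zero.mpr hx₁)]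
    · /- `P`, `Q` generic -/
      rw [if_neg hy₁, if_neg hy₂]
      by_cases hYc : -Y = m * x₃ + s
      · /- `P + Q = T`: `x₃ = 0`, `Y = -s`, `(y₁ - (mx₁+s))(y₂ - (mx₂+s))(-2s) = ν³` -/
        have hx₃0 : x₃ = 0 := (eq_negT_of_eq h hR (by linear_combination -hYc)).1
        have hYv : Y = -s := (eq_negT_of_eq h hR (by linear_combination -hYc)).2
        rw [if_pos hYc, ← cubeClass_mul (hsub hy₁) (hsub hy₂)]
        rw [hYv, hx₃0] at Cp
        have hν : y₁ - ℓ * x₁ - s ≠ 0 := by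
          intro h0
          rw [h0, zero_pow three_ne_zero, mul_eq_zero, mul_eq_zero] at Cp
          rcases Cp with (e | e) | e
          · exact hsub hy₁ e
          · exact hsub hy₂ e
          · exact h2s (by linear_combination -e)
        have key : (y₁ - (m * x₁ + s)) * (y₂ - (m * x₂ + s)) =
            (2 * s) ^ 2 * (-(y₁ - ℓ * x₁ - s) / (2 * s)) ^ 3 := by
          rw [div_pow, mul_div_assoc', eq_div_iff (pow_ne_zero 3 h2s)]
          linear_combination -(2 * s) ^ 2 * Cp
        rw [key, cubeClass_mul_pow_three h2s2 (div_ne_zero (neg_ne_zero.mpr hν) h2s)]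
      · rw [if_neg hYc]
        have hc₃0 : Y + (m * x₃ + s) ≠ 0 := fun e => hYc (by linear_combination -e)
        by_cases hYd' : Y = m * x₃ + s
        · /- `P + Q = -T`: `x₃ = 0`, `Y = s`; `(y₁ + (mx₁+s))(y₂ + (mx₂+s))(2s) = (y₁ - ℓx₁ + s)³` -/
          obtain ⟨hx₃0, hYv⟩ := eq_T_of_eq h hR hYd'
          rw [hYv, hx₃0] at Cm
          rw [hYv, hx₃0] at Cp
          rw [hYv, hx₃0]
          have hd₁ : y₁ + (m * x₁ + s) ≠ 0 := by
            intro e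
            obtain ⟨hx, hy⟩ := eq_negT_of_eq h h₁.left e
            -- then `Cp` reads `(-2s)(…)·0 = (-2s)³`
            rw [hx, hy] at Cp
            exact h2s (pow_eq_zero_iff three_ne_zero |>.mp (by linear_combination Cp))
          have hd₂ : y₂ + (m * x₂ + s) ≠ 0 := by
            intro e
            obtain ⟨hx, hy⟩ := eq_negT_of_eq h h₂.left e
            have hμ : y₁ - ℓ * x₁ = -s := by rw [hx, hy] at hline; linear_combination -hline
            have : (2 * s) ^ 3 = 0 := by
              have hν : y₁ - ℓ * x₁ - s = -(2 * s) := by linear_combination hμ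
              rw [hν] at Cp
              linear_combination Cp
            exact h2s (pow_eq_zero_iff three_ne_zero |>.mp this)
          have hμ : y₁ - ℓ * x₁ + s ≠ 0 := by
            intro h0
            rw [h0, zero_pow three_ne_zero, mul_eq_zero, mul_eq_zero] at Cm
            rcases Cm with (e | e) | e
            · exact hd₁ (by linear_combination e)
            · exact hd₂ (by linear_combination e)
            · exact h2s (by linear_combination e)
          have hx₁ : x₁ ≠ 0 := by
            intro hx; subst hx; apply hd₁
            have := hc₁; rw [zero_pow three_ne_zero, mul_eq_zero] at this
            exact this.resolve_left (hsub hy₁)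
          have hx₂ : x₂ ≠ 0 := by
            intro hx; subst hx; apply hd₂
            have := hc₂; rw [zero_pow three_ne_zero, mul_eq_zero] at this
            exact this.resolve_left (hsub hy₂)
          have key : (y₁ - (m * x₁ + s)) * (y₂ - (m * x₂ + s)) =
              (-s - (m * 0 + s)) * (-(x₁ * x₂) / (y₁ - ℓ * x₁ + s)) ^ 3 := by
            rw [div_pow, mul_div_assoc', eq_div_iff (pow_ne_zero 3 hμ)]
            linear_combination (-(y₁ - (m * x₁ + s)) * (y₂ - (m * x₂ + s))) * Cm +
              (2 * s * (y₂ - (m * x₂ + s)) * (y₂ + (m * x₂ + s))) * hc₁ + (2 * s * x₁ ^ 3) * hc₂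
          rw [← cubeClass_mul (hsub hy₁) (hsub hy₂), key, cubeClass_mul_pow_three
            (by intro e; exact h2s (by linear_combination -e))
            (div_ne_zero (neg_ne_zero.mpr (mul_ne_zero hx₁ hx₂)) hμ)]
        · /- everything generic: `(y₁ - (mx₁+s))(y₂ - (mx₂+s)) = -(Y + (mx₃+s)) · (-ν/x₃)³` -/
          have hd₃ : Y - (m * x₃ + s) ≠ 0 := sub_ne_zero.mpr hYd'
          have hx₃0 : x₃ ≠ 0 := by
            intro e; subst e; rw [zero_pow three_ne_zero, mul_eq_zero] at hc₃
            rcases hc₃ with e' | e'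
            · exact hd₃ e'
            · exact hc₃0 e'
          have hν : y₁ - ℓ * x₁ - s ≠ 0 := by
            intro h0
            rw [h0, zero_pow three_ne_zero, mul_eq_zero, mul_eq_zero] at Cp
            rcases Cp with (e | e) | e
            · exact hsub hy₁ e
            · exact hsub hy₂ e
            · exact hd₃ e
          have key : (y₁ - (m * x₁ + s)) * (y₂ - (m * x₂ + s)) =
              -(Y + (m * x₃ + s)) * (-(y₁ - ℓ * x₁ - s) / x₃) ^ 3 := by
            rw [div_pow, mul_div_assoc', eq_div_iff (pow_ne_zero 3 hx₃0)]
            linear_combination (Y + (m * x₃ + s)) * Cp -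
              (y₁ - (m * x₁ + s)) * (y₂ - (m * x₂ + s)) * hc₃
          rw [← cubeClass_mul (hsub hy₁) (hsub hy₂), key,
            show -Y - (m * x₃ + s) = -(Y + (m * x₃ + s)) by ring,
            cubeClass_mul_pow_three (neg_ne_zero.mpr hc₃0) (div_ne_zero (neg_ne_zero.mpr hν) hx₃0)]

/-- **The descent homomorphism exists**: there is an additive `κ : E_{m,s}(F) →+ F*/F*³` (additively written)
with `κ(x, y) = [y - (mx + s)]` off `T` and `κ(T) = [(2s)²]`. No definition is added to the tree: users
`obtain ⟨κ, hκ⟩`. [cite: Cohen2007NumberTheoryI, Prop. 8.4.8] -/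
theorem exists_threeDescentHom (h : IsVeluThreePair m s W W') :
    ∃ κ : W.toAffine.Point →+ Additive (CubeUnits F), ∀ x y (hP : W.toAffine.Nonsingular x y),
      κ (.some x y hP) =
        Additive.ofMul (cubeClass (if y = m * x + s then (2 * s) ^ 2 else y - (m * x + s))) := by
  let δ : W.toAffine.Point → F := fun P => match P with
    | .zero => 1
    | .some x y _ => if y = m * x + s then (2 * s) ^ 2 else y - (m * x + s)
  have hδ0 : δ 0 = 1 := rfl
  have hδ : ∀ x y (hP : W.toAffine.Nonsingular x y),
      δ (.some x y hP) = if y = m * x + s then (2 * s) ^ 2 else y - (m * x + s) := fun _ _ _ => rfl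
  refine ⟨{ toFun := fun P => Additive.ofMul (cubeClass (δ P))
            map_zero' := by simp only [hδ0, cubeClass_one]; rfl
            map_add' := fun P Q => by rw [cubeClass_descent_add h δ hδ0 hδ P Q]; rfl }, fun x y hP => ?_⟩
  rfl

/-- **The kernel of the descent map at an affine point**: `κ(x, y) = 0` iff either `(x, y) ≠ T` and
`y - (mx + s)` is a non-zero cube, or `(x, y) = T` and `(2s)²` is a cube. [folklore] -/
theorem descent_eq_zero_iff (h : IsVeluThreePair m s W W') (κ : W.toAffine.Point →+ Additive (CubeUnits F))
    (hκ : ∀ x y (hP : W.toAffine.Nonsingular x y), κ (.some x y hP) =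
      Additive.ofMul (cubeClass (if y = m * x + s then (2 * s) ^ 2 else y - (m * x + s))))
    {x y : F} (hP : W.toAffine.Nonsingular x y) :
    κ (.some x y hP) = 0 ↔
      (y ≠ m * x + s ∧ ∃ g : F, g ≠ 0 ∧ y - (m * x + s) = g ^ 3) ∨
        (y = m * x + s ∧ ∃ c : F, c ≠ 0 ∧ (2 * s) ^ 2 = c ^ 3) := by
  have h2s : (2 : F) * s ≠ 0 := mul_ne_zero h.two_ne h.s_ne
  rw [hκ, show (0 : Additive (CubeUnits F)) = Additive.ofMul 1 from rfl, Additive.ofMul.injective.eq_iff]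
  by_cases hy : y = m * x + s
  · rw [if_pos hy, cubeClass_eq_one_iff (pow_ne_zero 2 h2s)]
    simp [hy]
  · rw [if_neg hy, cubeClass_eq_one_iff (sub_ne_zero.mpr hy)]
    simp [hy]

/-- `(2s)²` is a cube iff `2s` is: `(2s)² = c³ ⇒ 2s = (2s/c)³`. [folklore] -/
theorem two_mul_s_eq_cube_of_sq (h2s : (2 : F) * s ≠ 0) {c : F} (e : (2 * s) ^ 2 = c ^ 3) :
    2 * s / c ≠ 0 ∧ 2 * s = (2 * s / c) ^ 3 := by
  have hc : c ≠ 0 := by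
    rintro rfl
    rw [zero_pow three_ne_zero] at e
    exact pow_ne_zero 2 h2s e
  refine ⟨div_ne_zero h2s hc, ?_⟩
  rw [div_pow, ← e, eq_div_iff (pow_ne_zero 2 h2s)]
  ring

end Summit.BirchSwinnertonDyer.BirchSwinnertonDyer.Rank2Observatory.ThreeIsoDescent
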